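import Literature.NumberTheory.ComplexMultiplication.CMTypeReadOnHodgeOneZero
import HarnessLib

/-!
# The first exponent of the Shimura–Taniyama character `χ_τ` at the base place is the first HODGE INDEX of the `τ`-eigenline

Layer `Literature/NumberTheory/ComplexMultiplication`.  THEOREMS ONLY (no definition, no named fact, no instance, no
`sorry`).  Cell hodgecm-mathlib, d6 line ([Liu2021] Thm. D.6 (1), one curve), HOME card `A-plan/d6/D6-LINE-CARD.A-plan2g11.md`
v3.4 §0′ (b) decision (ii) and §2 step 4: the GS2 / `SocketS2` infinity-type conjunct «`p w₁ = (1 − e w₁)/2`» of the glue probe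
(A-plan2 (g11) word 2026-08-29T20:45:39Z (b)).  Sequel of ★ `CMTypeReadOnHodgeOneZero` (node (J2)), which reads the CM type on
`H^{1,0}` and gives the type of `χ_τ` at the base place FOR `τ ∈ Φ`; this file adds the `τ ∉ Φ` half and packages both as
«the first exponent of `χ_τ` at the place `w` of the base embedding `σ₀ = algebraMap k ℂ` equals the first Hodge index `a` of a
non-zero `τ`-eigenvector of Hodge type `(a, b)`, `a + b = 1`» — so that, with `e w = 1 − 2a` (the infinity type
`((1−e)/2, (1+e)/2)` of `μ^{alg}`, ★ `hasInfinityType_muAlg`), the GS2 conjunct `p w = (1 − e w)/2` is one call.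

For a CM field `K` with CM type `Φ`, a number field `k ⊇ K*` inside `ℂ` (`[Algebra k ℂ] [Algebra (traceField Φ) k]
[IsScalarTower (traceField Φ) k ℂ]`, `σ₀ := algebraMap k ℂ`), `τ : K →+* ℂ`, and the reflex type `Ψ_τ(k) = reflexTypeOn Φ τ σ₀`
([Shimura1998] §13.1 (7)); `(cmInfinityType Φ τ σ₀).1 w = [σ_w ∈ Ψ_τ(k)]` ([Shimura1998] Prop. 19.10 (19.10a), ★ `cmInfinityType_fst`):

* §1 `algebraMap_mem_reflexTypeOn_iff` — **`σ₀ ∈ Ψ_τ(k) ↔ τ ∈ Φ`** (⟸ ★ `self_mem_reflexTypeOn`; ⟹: an automorphism of `ℂ`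
  fixing `σ₀(k) ⊇ K*` stabilises `Φ`, [Shimura1998] §8.3 Prop. 28 = ★ `forall_smul_mem_iff_of_forall_apply_traceField_eq`, read
  through ★ `mem_reflexTypeOn_iff_comp_algebraMap_traceField_mem_of_isScalarTower`); `conjugate_algebraMap_mem_reflexTypeOn_iff`
  — `σ̄₀ ∈ Ψ_τ(k) ↔ τ ∉ Φ` (the CM dichotomy ★ `conjugate_mem_reflexTypeOn_iff`);
* §2 the `τ ∉ Φ` half of (19.10a) at the base place: `cmInfinityType_eq_zero_one_of_not_mem` (`(p_w, q_w) = (0, 1)` when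
  `w.embedding = σ₀`), `cmInfinityType_eq_one_zero_of_not_mem` (`(1, 0)` when `w.embedding = σ̄₀`), and the two-case closed
  form `cmInfinityType_fst_of_embedding_eq` / `_of_embedding_eq_conjugate`;
* §3 THE LINK (complex abelian variety `A` with `IsCMTypeRealisation Φ A ι θ`, [Shimura1998] §5.2; `v ≠ 0` in the
  `τ`-eigenline of `θ` on `H¹(A(ℂ), ℂ)` of Hodge type `(a, b)`, `a + b = 1`):
  **`IsCMTypeRealisation.cmInfinityType_fst_eq_of_isOfHodgeType`** `(cmInfinityType Φ τ σ₀).1 w = a` for `w.embedding = σ₀`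
  (and `= b` for `w.embedding = σ̄₀`), the normalised form **`…_eq_half_one_sub`** `(cmInfinityType Φ τ σ₀).1 w = (1 − e w)/2`
  for `e w = 1 − 2a`, and the GS2-token packaging `HeckeCharacter.HasInfinityType.exists_fst_eq`
  `ψ.HasInfinityType (cmIT).1 (cmIT).2 → (cmIT).1 w₁ = e₁ → ∃ p q, ψ.HasInfinityType p q ∧ p w₁ = e₁`.
Over a number field `E ⊂ ℂ` the consumer instantiates `A := B′.baseChange ℂ` from `IsCMTypeRealisationOver Φ B′ ρ`
(★ `isCMTypeRealisationOver_iff`), `k := E`.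

HC_CM is proved only modulo the 7 printed citations until rung 0 closes; this file asserts nothing about HC and moves no book.

## References
* [Shimura1998] G. Shimura, *Abelian Varieties with Complex Multiplication and Modular Functions* (1998): §5.2 (pp. 39–40),
  §8.3 Prop. 28, §13.1 (7), Prop. 19.10 (19.10a) (p. 135).
* [MilneCM2006] J. S. Milne, *Complex Multiplication* (notes), Ch. I §1 Prop. 1.23.
* [Liu2021] Y. Liu, Camb. J. Math. **9** (2021), App. D, proof of Thm. D.6 (1) (FJcycle.tex l. 5625–5630: the infinity type
  decides between `μ|·|^{−1/2}` and `μ^c χ̌|·|^{−1/2}`).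
-/

set_option autoImplicit false

noncomputable section

open NumberField
open Literature.AlgebraicGeometry.Motives (CMType AbelianVariety)
open Literature.AlgebraicGeometry.HodgeTheory
open Literature.NumberTheory.Automorphic.PicardCM (eigenline)

namespace Literature.NumberTheory.ComplexMultiplication

variable (K : Type) [Field K] [NumberField K] [NumberField.IsCMField K] (Φ : CMType K) {k : Type} [Field k] [NumberField k]
  [Algebra k ℂ] [Algebra (traceField Φ) k] [IsScalarTower (traceField Φ) k ℂ]

/-! ## §1 The base embedding and the reflex type: `σ₀ ∈ Ψ_τ(k) ↔ τ ∈ Φ` -/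

omit [NumberField.IsCMField K] in
/-- **`σ₀ ∈ Ψ_τ(k) ↔ τ ∈ Φ`** for the base embedding `σ₀ = algebraMap k ℂ` of a number field `k ⊇ K*`: (⟸) take `g = 1` in
`Ψ_τ = {g ∘ σ₀ | g⁻¹ ∘ τ ∈ Φ}`; (⟹) restricted to `K*`, a `g ∈ Aut(ℂ)` with `g⁻¹ ∘ τ ∈ Φ` fixing `K*` pointwise stabilises `Φ`
(Prop. 28), so `τ = g ∘ (g⁻¹ ∘ τ) ∈ Φ`. [cite: Shimura1998, §13.1 (7) and §8.3 Prop. 28] [cite: MilneCM2006, Ch. I §1 Prop. 1.23] -/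
theorem algebraMap_mem_reflexTypeOn_iff (τ : K →+* ℂ) :
    algebraMap k ℂ ∈ reflexTypeOn Φ.1 τ (algebraMap k ℂ) ↔ τ ∈ Φ.1 := by
  refine ⟨fun h => ?_, fun hτ => self_mem_reflexTypeOn _ hτ⟩
  rw [mem_reflexTypeOn_iff_comp_algebraMap_traceField_mem_of_isScalarTower K Φ τ,
    algebraMap_comp_algebraMap_traceField_of_isScalarTower K Φ, mem_reflexTypeOn_iff] at h
  obtain ⟨g, hg, hgσ⟩ := h
  have hfix : ∀ z : ℂ, z ∈ traceField Φ → g z = z := fun z hz => by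
    have hz' := RingHom.congr_fun hgσ ⟨z, hz⟩
    simpa [ringEquiv_smul_def] using hz'
  have hstab := forall_smul_mem_iff_of_forall_apply_traceField_eq g Φ hfix (g⁻¹ • τ)
  rw [smul_inv_smul] at hstab
  exact hstab.2 hg

/-- **`σ̄₀ ∈ Ψ_τ(k) ↔ τ ∉ Φ`** — the CM dichotomy `σ̄ ∈ Ψ_τ ↔ σ ∉ Ψ_τ` at the base embedding.
[cite: Shimura1998, §13.1 (7)] [cite: MilneCM2006, Ch. I §1 Prop. 1.23] -/
theorem conjugate_algebraMap_mem_reflexTypeOn_iff (τ : K →+* ℂ) :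
    ComplexEmbedding.conjugate (algebraMap k ℂ) ∈ reflexTypeOn Φ.1 τ (algebraMap k ℂ) ↔ τ ∉ Φ.1 := by
  rw [conjugate_mem_reflexTypeOn_iff K Φ τ, algebraMap_mem_reflexTypeOn_iff K Φ τ]

/-! ## §2 (19.10a) at the base place for `τ ∉ Φ` -/

omit [NumberField K] [NumberField.IsCMField K] [NumberField k] [Algebra (traceField Φ) k]
  [IsScalarTower (traceField Φ) k ℂ] in
/-- Conjugating twice gives the embedding back. [cite: Shimura1998, §13.1 (7)] -/
private theorem conjugate_conjugate_eq'' {k' : Type} [Field k'] (σ : k' →+* ℂ) :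
    ComplexEmbedding.conjugate (ComplexEmbedding.conjugate σ) = σ :=
  RingHom.ext fun x => by simp

/-- For `τ ∉ Φ`, the base embedding is NOT in `Ψ_τ(k)` and its conjugate IS. [cite: Shimura1998, §13.1 (7)] -/
theorem algebraMap_not_mem_reflexTypeOn_and_conjugate_mem {τ : K →+* ℂ} (hτ : τ ∉ Φ.1) :
    algebraMap k ℂ ∉ reflexTypeOn Φ.1 τ (algebraMap k ℂ) ∧
      ComplexEmbedding.conjugate (algebraMap k ℂ) ∈ reflexTypeOn Φ.1 τ (algebraMap k ℂ) :=
  ⟨fun h => hτ ((algebraMap_mem_reflexTypeOn_iff K Φ τ).1 h), (conjugate_algebraMap_mem_reflexTypeOn_iff K Φ τ).2 hτ⟩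

/-- **The infinity type of `χ_τ` at the place of the base embedding, `τ ∉ Φ`: `(p_w, q_w) = (0, 1)`** when
`w.embedding = algebraMap k ℂ` ((19.10a): `p_w = [σ_w ∈ Ψ_τ]`, `q_w = [σ̄_w ∈ Ψ_τ]`). [cite: Shimura1998, Prop. 19.10 (19.10a)] -/
theorem cmInfinityType_eq_zero_one_of_not_mem {τ : K →+* ℂ} (hτ : τ ∉ Φ.1) (w : InfinitePlace k)
    (hw : w.embedding = algebraMap k ℂ) :
    (cmInfinityType Φ.1 τ (algebraMap k ℂ)).1 w = 0 ∧ (cmInfinityType Φ.1 τ (algebraMap k ℂ)).2 w = 1 := by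
  obtain ⟨hnot, hmem⟩ := algebraMap_not_mem_reflexTypeOn_and_conjugate_mem K Φ (k := k) hτ
  have hwc : ¬w.IsReal := by
    rw [InfinitePlace.isReal_iff, hw]
    intro hreal
    apply hnot
    have h := ComplexEmbedding.isReal_iff.1 hreal
    convert hmem using 2
    exact h.symm
  refine ⟨?_, ?_⟩
  · rw [cmInfinityType_fst, hw, Set.indicator_of_notMem hnot]
  · rw [cmInfinityType_snd, if_neg hwc, hw, Set.indicator_of_mem hmem]

/-- **… and `(p_w, q_w) = (1, 0)` for `τ ∉ Φ`** when `w.embedding` is the CONJUGATE of the base embedding.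
[cite: Shimura1998, Prop. 19.10 (19.10a)] -/
theorem cmInfinityType_eq_one_zero_of_not_mem {τ : K →+* ℂ} (hτ : τ ∉ Φ.1) (w : InfinitePlace k)
    (hw : w.embedding = ComplexEmbedding.conjugate (algebraMap k ℂ)) :
    (cmInfinityType Φ.1 τ (algebraMap k ℂ)).1 w = 1 ∧ (cmInfinityType Φ.1 τ (algebraMap k ℂ)).2 w = 0 := by
  obtain ⟨hnot, hmem⟩ := algebraMap_not_mem_reflexTypeOn_and_conjugate_mem K Φ (k := k) hτ
  have hwc : ¬w.IsReal := by
    rw [InfinitePlace.isReal_iff, hw]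
    intro hreal
    apply hnot
    have h := ComplexEmbedding.isReal_iff.1 hreal
    rw [conjugate_conjugate_eq''] at h
    convert hmem using 2
  refine ⟨?_, ?_⟩
  · rw [cmInfinityType_fst, hw, Set.indicator_of_mem hmem]
  · rw [cmInfinityType_snd, if_neg hwc, hw, conjugate_conjugate_eq'', Set.indicator_of_notMem hnot]

open scoped Classical in
/-- **Closed form at the base place**: `p_w(χ_τ) = [τ ∈ Φ]` when `w.embedding = σ₀`. [cite: Shimura1998, Prop. 19.10 (19.10a)] -/
theorem cmInfinityType_fst_of_embedding_eq (τ : K →+* ℂ) (w : InfinitePlace k) (hw : w.embedding = algebraMap k ℂ) :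
    (cmInfinityType Φ.1 τ (algebraMap k ℂ)).1 w = if τ ∈ Φ.1 then 1 else 0 := by
  split_ifs with hτ
  · exact (cmInfinityType_eq_one_zero_of_mem K Φ hτ w hw).1
  · exact (cmInfinityType_eq_zero_one_of_not_mem K Φ hτ w hw).1

open scoped Classical in
/-- **Closed form at the conjugate place datum**: `p_w(χ_τ) = [τ ∉ Φ]` when `w.embedding = σ̄₀`.
[cite: Shimura1998, Prop. 19.10 (19.10a)] -/
theorem cmInfinityType_fst_of_embedding_eq_conjugate (τ : K →+* ℂ) (w : InfinitePlace k)
    (hw : w.embedding = ComplexEmbedding.conjugate (algebraMap k ℂ)) :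
    (cmInfinityType Φ.1 τ (algebraMap k ℂ)).1 w = if τ ∈ Φ.1 then 0 else 1 := by
  split_ifs with hτ
  · exact (cmInfinityType_eq_zero_one_of_mem K Φ hτ w hw).1
  · exact (cmInfinityType_eq_one_zero_of_not_mem K Φ hτ w hw).1

/-! ## §3 The link with the Hodge type of the `τ`-eigenline -/

variable {K Φ}
variable {A : AbelianVariety ℂ} {ι : 𝓞 K →+* CategoryTheory.End A} {θ : K →+* Module.End ℂ (complexBetti A.X 1)}

/-- **The first exponent of `χ_τ` at the base place is the first Hodge index of the `τ`-eigenline.**  For a structure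
`(A, ι)` of type `(K, Φ)` over `ℂ` read on `H¹` (`IsCMTypeRealisation Φ A ι θ`) and a NON-ZERO `τ`-eigenvector `v` of Hodge
type `(a, b)` with `a + b = 1`: `p_w(χ_τ) = a` at the place `w` with `w.embedding = σ₀` — type `(1,0)` forces `τ ∈ Φ`
(★ `mem_of_isOfHodgeType_oneZero`) hence `p_w = 1`; type `(0,1)` forces `τ ∉ Φ` hence `p_w = 0`.
[cite: Shimura1998, §5.2 (pp. 39–40) and Prop. 19.10 (19.10a)] -/
theorem _root_.Literature.AlgebraicGeometry.ComplexMultiplication.IsCMTypeRealisation.cmInfinityType_fst_eq_of_isOfHodgeType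
    (h : Literature.AlgebraicGeometry.ComplexMultiplication.IsCMTypeRealisation Φ A ι θ) {τ : K →+* ℂ}
    {v : complexBetti A.X 1} (hv : v ∈ eigenline θ τ) (hv0 : v ≠ 0) {a b : ℕ}
    (hab : IsOfHodgeType (Module.finrank ℚ K / 2) A.X 1 a b v) (h1 : a + b = 1)
    (w : InfinitePlace k) (hw : w.embedding = algebraMap k ℂ) :
    (cmInfinityType Φ.1 τ (algebraMap k ℂ)).1 w = a := by
  rcases Nat.eq_zero_or_pos a with rfl | ha
  · have hb : b = 1 := by omega
    subst hb
    exact (cmInfinityType_eq_zero_one_of_not_mem K Φ (h.not_mem_of_isOfHodgeType_zeroOne hv hv0 hab) w hw).1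
  · have ha1 : a = 1 := by omega
    have hb : b = 0 := by omega
    subst ha1 hb
    exact (cmInfinityType_eq_one_zero_of_mem K Φ (h.mem_of_isOfHodgeType_oneZero hv hv0 hab) w hw).1

/-- **Conjugate twin**: at a place `w` with `w.embedding = σ̄₀`, `p_w(χ_τ) = b`, the SECOND Hodge index of the `τ`-eigenline.
[cite: Shimura1998, §5.2 (pp. 39–40) and Prop. 19.10 (19.10a)] -/
theorem _root_.Literature.AlgebraicGeometry.ComplexMultiplication.IsCMTypeRealisation.cmInfinityType_fst_eq_of_isOfHodgeType_conjugate
    (h : Literature.AlgebraicGeometry.ComplexMultiplication.IsCMTypeRealisation Φ A ι θ) {τ : K →+* ℂ}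
    {v : complexBetti A.X 1} (hv : v ∈ eigenline θ τ) (hv0 : v ≠ 0) {a b : ℕ}
    (hab : IsOfHodgeType (Module.finrank ℚ K / 2) A.X 1 a b v) (h1 : a + b = 1)
    (w : InfinitePlace k) (hw : w.embedding = ComplexEmbedding.conjugate (algebraMap k ℂ)) :
    (cmInfinityType Φ.1 τ (algebraMap k ℂ)).1 w = b := by
  rcases Nat.eq_zero_or_pos a with rfl | ha
  · have hb : b = 1 := by omega
    subst hb
    exact (cmInfinityType_eq_one_zero_of_not_mem K Φ (h.not_mem_of_isOfHodgeType_zeroOne hv hv0 hab) w hw).1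
  · have ha1 : a = 1 := by omega
    have hb : b = 0 := by omega
    subst ha1 hb
    exact (cmInfinityType_eq_zero_one_of_mem K Φ (h.mem_of_isOfHodgeType_oneZero hv hv0 hab) w hw).1

/-- **THE GS2 TOKEN `p w = (1 − e w)/2`.**  With `μ^{alg}` of infinity type `((1−e)/2, (1+e)/2)` (★ `hasInfinityType_muAlg`) and
the `τ`-eigenline of Hodge type `(a, b)`, `a + b = 1`, at the base place `w` (`w.embedding = σ₀`), normalised by `e w = 1 − 2a`
(`a = 1 ↔ e w = −1`): the first exponent of `χ_τ` at `w` is `(1 − e w)/2`.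
[cite: Shimura1998, §5.2 (pp. 39–40) and Prop. 19.10 (19.10a)] [cite: Liu2021, App. D, proof of Thm. D.6 (1) (FJcycle.tex l. 5625–5630)] -/
theorem _root_.Literature.AlgebraicGeometry.ComplexMultiplication.IsCMTypeRealisation.cmInfinityType_fst_eq_half_one_sub
    (h : Literature.AlgebraicGeometry.ComplexMultiplication.IsCMTypeRealisation Φ A ι θ) {τ : K →+* ℂ}
    {v : complexBetti A.X 1} (hv : v ∈ eigenline θ τ) (hv0 : v ≠ 0) {a b : ℕ}
    (hab : IsOfHodgeType (Module.finrank ℚ K / 2) A.X 1 a b v) (h1 : a + b = 1)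
    (w : InfinitePlace k) (hw : w.embedding = algebraMap k ℂ) {e : InfinitePlace k → ℤ} (he : e w = 1 - 2 * a) :
    (cmInfinityType Φ.1 τ (algebraMap k ℂ)).1 w = (1 - e w) / 2 := by
  rw [h.cmInfinityType_fst_eq_of_isOfHodgeType hv hv0 hab h1 w hw, he]
  omega

end Literature.NumberTheory.ComplexMultiplication

/-! ## §4 Packaging in the shape of the probe's GS2 first conjunct -/

namespace Literature.NumberTheory.GaloisRepresentations.HeckeCharacter

/-- `∃ p q, ψ.HasInfinityType p q ∧ p w₁ = e₁` — the first conjunct of the d6 probe's `GS2`, from an infinity type `(p, q)` whose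
first exponent at `w₁` has been computed. [cite: Shimura1998, Prop. 19.10 (19.10a)] -/
theorem HasInfinityType.exists_fst_eq {k : Type} [Field k] [NumberField k] {ψ : HeckeCharacter k}
    {p q : InfinitePlace k → ℤ} (hψ : ψ.HasInfinityType p q) {w₁ : InfinitePlace k} {e₁ : ℤ} (h : p w₁ = e₁) :
    ∃ p' q' : InfinitePlace k → ℤ, ψ.HasInfinityType p' q' ∧ p' w₁ = e₁ :=
  ⟨p, q, hψ, h⟩

end Literature.NumberTheory.GaloisRepresentations.HeckeCharacter
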